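import Summits.Ventures.PercRepro.C026C028SureReduction
import Summits.Ventures.PercRepro.C026C028Reduction

/-!
# C-028(c) on every marked multigraph from the single step (A) in sure-cluster form (p6, gen 15;
mine-3 MINE3-GLUING v4 §7 (5))

The induction of `C026C028SureReduction` assembled: `C028StepSure` is mine-3's step (A) read in the
weight vocabulary — a fractional edge with one end surely joined to the mark `a` and the other end `y`
surely joined to no mark, with C-028(c) for every marking of both minors — and
**`C028At_of_stepSure` : `C028StepSure` ⟹ ROW C-028(c) at every weight vector of every marked
multigraph** (hence C-035 and C-026, `C026At_of_stepSure`).  When no fractional edge touches the sure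
cluster of `a`, the cluster of `a` is the sure cluster almost surely, `{a ↔ b}` is deterministic and
the defect is `0` (`C028At_of_no_fracEdge_at_cluster`).
-/

namespace PercRepro

open Finset

namespace MultiGraph

variable {V E : Type*} (G : MultiGraph V E) [Fintype E] [DecidableEq E]

/-! ### No fractional edge at the sure cluster of `a` -/

omit [DecidableEq E] in
/-- If every edge touching the sure cluster of `a` is surely open or surely closed, then on every
positive-weight configuration the cluster of `a` is its sure cluster. -/
theorem sureConn_of_conn_of_no_frac {p : E → ℝ} {a : V}
    (hnofrac : ∀ e, (G.SureConn p a (G.fst e) ∨ G.SureConn p a (G.snd e)) → p e = 0 ∨ p e = 1)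
    {ω : Config E} (hω : 0 < weight p ω) {v : V} (h : G.Conn ω a v) : G.SureConn p a v := by
  refine Conn.induction (motive := fun v => G.SureConn p a v) (Conn.refl G _ a) ?_ h
  intro u w _ hadj hsure
  obtain ⟨e, he, hends⟩ := hadj
  have htouch : G.SureConn p a (G.fst e) ∨ G.SureConn p a (G.snd e) := by
    rcases hends with ⟨h1, _⟩ | ⟨_, h2⟩
    · exact Or.inl (h1 ▸ hsure)
    · exact Or.inr (h2 ▸ hsure)
  rcases hnofrac e htouch with h0 | h1
  · exact absurd he (by rw [eq_false_of_weight_pos hω h0]; decide)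
  · have hs : sureConfig p e = true := by simp [sureConfig, h1]
    exact Conn.trans (show G.Conn (sureConfig p) a u from hsure) (Conn.of_openAdj ⟨e, hs, hends⟩)

/-- **No fractional edge at the sure cluster of `a`**: `{a ↔ b}` is deterministic, the C-028 defect is
`0`, C-028(c) holds. -/
theorem C028At_of_no_fracEdge_at_cluster {p : E → ℝ} (hp : IsProb p) {a : V}
    (hnofrac : ∀ e, (G.SureConn p a (G.fst e) ∨ G.SureConn p a (G.snd e)) → p e = 0 ∨ p e = 1)
    (b c : V) : G.C028At p a b c := by
  have hA := G.law3_zero_add_one p a b c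
  have hAc := G.law3_two_add_three_add_four p a b c
  have hs : prob p (G.sepEvent a b) = 1 - prob p (G.connEvent a b) := prob_compl _ _
  have h0n := prob_nonneg hp (G.partitionEvent ![a, b, c] ![0, 0, 0])
  have h1n := prob_nonneg hp (G.partitionEvent ![a, b, c] ![0, 0, 1])
  have h2n := prob_nonneg hp (G.partitionEvent ![a, b, c] ![0, 1, 0])
  have h3n := prob_nonneg hp (G.partitionEvent ![a, b, c] ![0, 1, 1])
  have h4n := prob_nonneg hp (G.partitionEvent ![a, b, c] ![0, 1, 2])
  rw [← law3_zero] at h0n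
  rw [← law3_one] at h1n
  rw [← law3_two] at h2n
  rw [← law3_three] at h3n
  rw [← law3_four] at h4n
  unfold C028At c028Cov
  by_cases hab : G.SureConn p a b
  · have hP : prob p (G.connEvent a b) = 1 := by
      rw [← prob_univ p]
      refine prob_eq_of_eqOn_pos hp fun ω hω => ?_
      simp only [mem_connEvent, Set.mem_univ, iff_true]
      exact G.conn_of_sureConn_of_weight_pos hω hab
    have h2 : G.law3 p a b c 2 = 0 := by linarith
    have h3 : G.law3 p a b c 3 = 0 := by linarith
    rw [h2, h3, hA, hP]
    have : G.law3 p a b c 0 - 1 * (G.law3 p a b c 0 + 0 + 0) = 0 := by ring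
    rw [this, mul_zero, Real.sqrt_zero]
  · have hP : prob p (G.connEvent a b) = 0 := by
      rw [← prob_empty p]
      refine prob_eq_of_eqOn_pos hp fun ω hω => ?_
      simp only [mem_connEvent, Set.mem_empty_iff_false, iff_false]
      intro h
      exact hab (G.sureConn_of_conn_of_no_frac hnofrac hω h)
    have h0 : G.law3 p a b c 0 = 0 := by linarith
    have h1 : G.law3 p a b c 1 = 0 := by linarith
    rw [h0, h1]
    have : (0 : ℝ) - (0 + 0) * (0 + G.law3 p a b c 2 + G.law3 p a b c 3) = 0 := by ring
    rw [this]
    exact Real.sqrt_nonneg _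

/-! ### The reduction to the single step (A) -/

/-- **Step (A) in sure-cluster form** (mine-3 §7 (5), weight vocabulary): at a fractional edge `e` with
one end surely joined to the mark `a` and the other end `y` surely joined to no mark, C-028(c) for every
marking of both minors gives C-028(c) at `p`. -/
def C028StepSure : Prop :=
  ∀ (p : E → ℝ) (e : E) (a b c y : V), IsProb p → p e ≠ 0 → p e ≠ 1 →
    ((G.SureConn p a (G.fst e) ∧ G.snd e = y) ∨ (G.SureConn p a (G.snd e) ∧ G.fst e = y)) →
    ¬ G.SureConn p a y → ¬ G.SureConn p b y → ¬ G.SureConn p c y →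
    G.C028Minors p e → G.C028At p a b c

/-- The one-edge step at a fractional edge touching the sure cluster of `a`. -/
theorem C028At_step_sure (hA : G.C028StepSure) {p : E → ℝ} (hp : IsProb p) {e : E}
    (he0 : p e ≠ 0) (he1 : p e ≠ 1) (hIH : G.C028Minors p e) {a : V}
    (hx : G.SureConn p a (G.fst e) ∨ G.SureConn p a (G.snd e)) (b c : V) :
    G.C028At p a b c := by
  have h0 := hIH.1 a b c
  rcases hx with hx | hx
  · by_cases hay : G.SureConn p a (G.snd e)
    · exact G.C028At_of_sureConn_endpoints hp he1
        (Conn.trans (Conn.symm (show G.Conn (sureConfig p) a (G.fst e) from hx)) hay) h0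
    by_cases hby : G.SureConn p b (G.snd e)
    · exact G.C028At_of_sureEdge_ab hp he1 (Or.inl ⟨hx, hby⟩) c h0
    by_cases hcy : G.SureConn p c (G.snd e)
    · exact G.C028At_of_sureEdge_ac hp he1 (Or.inl ⟨hx, hcy⟩) b h0
    exact hA p e a b c (G.snd e) hp he0 he1 (Or.inl ⟨hx, rfl⟩) hay hby hcy hIH
  · by_cases hay : G.SureConn p a (G.fst e)
    · exact G.C028At_of_sureConn_endpoints hp he1
        (Conn.trans (Conn.symm (show G.Conn (sureConfig p) a (G.fst e) from hay)) hx) h0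
    by_cases hby : G.SureConn p b (G.fst e)
    · exact G.C028At_of_sureEdge_ab hp he1 (Or.inr ⟨hx, hby⟩) c h0
    by_cases hcy : G.SureConn p c (G.fst e)
    · exact G.C028At_of_sureEdge_ac hp he1 (Or.inr ⟨hx, hcy⟩) b h0
    exact hA p e a b c (G.fst e) hp he0 he1 (Or.inr ⟨hx, rfl⟩) hay hby hcy hIH

/-- **THE REDUCTION TO (A)** (mine-3 §7 (5)): the step (A) in sure-cluster form gives ROW C-028(c) on
every marked multigraph at every weight vector. -/
theorem C028At_of_stepSure (hA : G.C028StepSure) :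
    ∀ p : E → ℝ, IsProb p → ∀ a b c : V, G.C028At p a b c := by
  suffices H : ∀ n : ℕ, ∀ p : E → ℝ, IsProb p → (fracEdges p).card = n →
      ∀ a b c : V, G.C028At p a b c by
    intro p hp
    exact H _ p hp rfl
  intro n
  refine Nat.strong_induction_on n ?_
  intro n ih p hp hn a b c
  by_cases hF : ∃ e ∈ fracEdges p, G.SureConn p a (G.fst e) ∨ G.SureConn p a (G.snd e)
  · obtain ⟨e, he, hx⟩ := hF
    have he' := he
    simp only [fracEdges, Finset.mem_filter, Finset.mem_univ, true_and] at he'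
    have hIH : G.C028Minors p e :=
      ⟨fun a' b' c' => ih _ (hn ▸ card_fracEdges_update_lt he (Or.inl rfl)) _
          (hp.update e ⟨le_rfl, zero_le_one⟩) rfl a' b' c',
        fun a' b' c' => ih _ (hn ▸ card_fracEdges_update_lt he (Or.inr rfl)) _
          (hp.update e ⟨zero_le_one, le_rfl⟩) rfl a' b' c'⟩
    exact G.C028At_step_sure hA hp he'.1 he'.2 hIH hx b c
  · refine G.C028At_of_no_fracEdge_at_cluster hp (fun e htouch => ?_) b c
    by_contra hcon
    refine hF ⟨e, ?_, htouch⟩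
    simp only [fracEdges, Finset.mem_filter, Finset.mem_univ, true_and]
    exact ⟨fun h => hcon (Or.inl h), fun h => hcon (Or.inr h)⟩

/-- **C-026 from the single step (A)**: with `C028StepSure`, ROW C-026 holds on every marked multigraph
at every weight vector. -/
theorem C026At_of_stepSure {V E : Type} (G : MultiGraph V E) [Fintype E] [DecidableEq E]
    (hA : G.C028StepSure) : ∀ p : E → ℝ, IsProb p → ∀ a b c : V, G.C026At p a b c :=
  fun p hp a b c => G.C026At_of_C028At hp (G.C028At_of_stepSure hA p hp a b c)

end MultiGraph

end PercRepro
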